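import Literature.Probability.LatticeModels.LatticeHarnackOneScale

/-!
# Oscillation decay for nonnegative lattice-harmonic functions in boxes of `ℤ²`
# (helper for stub `stub_touchProfileLaws`, towards `PoissonHarnackModulus`)

Line `kenyon-stream-second-relation` of the crux `ParafermionPrecompact` (route `CardySusyWard`,
item stmt-CriticalPhenomena-11293). Deterministic discrete potential theory on `ℤ²`, built on the
tree's one-scale Harnack inequality `harnack_one_scale` (Lawler–Schramm–Werner 2004, Lemma 5.2;
boxes `mW v k` of radius `48k` and `mB v k` of radius `12k`, universal constant
`c_* = maneuverConst > 0`):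

* `holeFree_box` — a coordinate box `{|x₀ - c₀| ≤ n, |x₁ - c₁| ≤ n}` is hole-free (every outside
  face escapes upwards, after a horizontal run below the box if necessary); in particular the boxes
  `mW v k` are admissible regions for `harnack_one_scale`.
* `harnack_two_sided` — TWO-SIDED HARNACK: if `h` is lattice harmonic on `mW v (2k)` and
  nonnegative on it and on its outer boundary, then `(c_*/2) h v ≤ h x` and `(c_*/2) h x ≤ h v` for
  every `x ∈ mB v k` (the second by re-centring the one-scale inequality at `x`).
* `harnack_modulus_box` (registered helper) — OSCILLATION DECAY (Moser iteration of the two-sided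
  Harnack inequality over the scales `k, 9k, …, 9^N k`): there are universal `A > 0` and
  `θ ∈ [0, 1)` such that `|h x - h v| ≤ A θ^N h v` for `x ∈ mB v k` whenever `h ≥ 0` is lattice
  harmonic on `mW v (2 · 9^N k)` (nonnegative on it and its outer boundary). This is the
  difference estimate for positive harmonic functions (Lawler–Limic 2010, Thm. 6.3.8–6.3.9) in the
  qualitative (Hölder) form that suffices for equicontinuity statements.

References: G. F. Lawler, O. Schramm, W. Werner, Ann. Probab. 32 (2004), Lemma 5.2
[LawlerSchrammWerner2004]; G. F. Lawler, V. Limic, *Random Walk: A Modern Introduction* (2010),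
Thm. 6.3.8–6.3.9 [LawlerLimic2010]; J. Moser, Comm. Pure Appl. Math. 14 (1961) (oscillation
iteration). Elementary given the tree's `harnack_one_scale`; tagged `[folklore]`.
-/

noncomputable section

namespace Summit.CriticalPhenomena.CardyFormulaZ2.Cruxes.ParafermionPrecompact.KenyonStreamSecondRelation

open Set
open _root_.Literature.Probability.LatticeModels

/-! ### Coordinate boxes are hole-free -/

/-- Coordinates of a point moved `t` steps along `eᵢ`. [folklore] -/
theorem add_zsmul_single_apply (g : Site 2) (i j : Fin 2) (t : ℤ) :
    (g + t • (Pi.single i 1 : Site 2)) j = g j + if j = i then t else 0 := by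
  simp only [Pi.add_apply, Pi.smul_apply, Pi.single_apply, smul_eq_mul, mul_ite, mul_one, mul_zero]

/-- A straight run along `eᵢ` all of whose sites avoid `P` is a chain of face steps avoiding `P`.
[folklore] -/
theorem reflTransGen_faceStep_run {P : Set (Site 2)} (g : Site 2) (i : Fin 2) (T : ℕ)
    (h : ∀ t : ℕ, t ≤ T → g + (t : ℤ) • (Pi.single i 1 : Site 2) ∉ P) :
    Relation.ReflTransGen (FaceStep P) g (g + (T : ℤ) • (Pi.single i 1 : Site 2)) := by
  induction T with
  | zero =>
    simp only [Nat.cast_zero, zero_smul, add_zero]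
    exact Relation.ReflTransGen.refl
  | succ T ih =>
    have ih' := ih fun t ht => h t (Nat.le_succ_of_le ht)
    refine ih'.tail ⟨?_, h T (Nat.le_succ T), h (T + 1) le_rfl⟩
    have hstep : g + ((T + 1 : ℕ) : ℤ) • (Pi.single i 1 : Site 2) =
        (g + (T : ℤ) • (Pi.single i 1 : Site 2)) + Pi.single i 1 := by
      push_cast
      rw [add_smul, one_smul, add_assoc]
    rw [hstep]
    exact (zdGraph_adj_iff _ _).2 ⟨i, Or.inl rfl⟩

/-- **A coordinate box is hole-free**: every face outside `{|x₀ - c₀| ≤ n, |x₁ - c₁| ≤ n}` is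
joined, outside the box, to faces of arbitrarily large ordinate (straight up if its column misses
the box or it lies above the box; otherwise it lies below the box: run right past the box, then
up). [folklore] -/
theorem holeFree_box (c : Site 2) (n : ℤ) :
    HoleFree {x : Site 2 | |x 0 - c 0| ≤ n ∧ |x 1 - c 1| ≤ n} := by
  intro g hg M
  set P : Set (Site 2) := {x : Site 2 | |x 0 - c 0| ≤ n ∧ |x 1 - c 1| ≤ n} with hP
  have hmem : ∀ x : Site 2, x ∈ P ↔ |x 0 - c 0| ≤ n ∧ |x 1 - c 1| ≤ n := fun x => Iff.rfl
  -- a vertical run from a site whose column or height keeps it outside the box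
  have up : ∀ g' : Site 2, (n < |g' 0 - c 0| ∨ c 1 + n < g' 1) →
      ∃ g'', M ≤ g'' 1 ∧ Relation.ReflTransGen (FaceStep P) g' g'' := by
    intro g' hg'
    set T : ℕ := (M - g' 1).toNat with hT
    have hTM : M ≤ g' 1 + T := by have := Int.self_le_toNat (M - g' 1); omega
    refine ⟨g' + (T : ℤ) • (Pi.single 1 1 : Site 2), ?_, reflTransGen_faceStep_run g' 1 T ?_⟩
    · rw [add_zsmul_single_apply]; simpa using hTM
    · intro t _ ht
      rw [hmem, add_zsmul_single_apply, add_zsmul_single_apply] at ht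
      simp only [Fin.isValue, zero_ne_one, ↓reduceIte, add_zero] at ht
      rcases hg' with h0 | h1
      · exact absurd ht.1 (not_le.2 h0)
      · have := ht.2; rw [abs_le] at this; omega
  by_cases h0 : n < |g 0 - c 0|
  · exact up g (Or.inl h0)
  · have h1 : n < |g 1 - c 1| := by
      rw [not_lt] at h0
      by_contra h1
      exact hg ⟨h0, not_lt.1 h1⟩
    by_cases hup : c 1 + n < g 1
    · exact up g (Or.inr hup)
    · -- below the box: run right to the column `c 0 + n + 1`, then up
      have hdown : g 1 < c 1 - n := by
        rw [not_lt] at hup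
        by_contra hle
        rw [not_lt] at hle
        have : |g 1 - c 1| ≤ n := abs_le.2 ⟨by omega, by omega⟩
        exact absurd h1 (not_lt.2 this)
      have hg0 : g 0 ≤ c 0 + n := by rw [not_lt, abs_le] at h0; omega
      set S : ℕ := (c 0 + n + 1 - g 0).toNat with hS
      have hS' : (S : ℤ) = c 0 + n + 1 - g 0 := Int.toNat_of_nonneg (by omega)
      set g' : Site 2 := g + (S : ℤ) • (Pi.single 0 1 : Site 2) with hg'
      have hrun : Relation.ReflTransGen (FaceStep P) g g' := by
        refine reflTransGen_faceStep_run g 0 S fun t _ ht => ?_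
        rw [hmem, add_zsmul_single_apply, add_zsmul_single_apply] at ht
        simp only [Fin.isValue, ↓reduceIte, one_ne_zero, add_zero] at ht
        have := ht.2; rw [abs_le] at this; omega
      have hcol : n < |g' 0 - c 0| := by
        rw [hg', add_zsmul_single_apply]
        simp only [Fin.isValue, ↓reduceIte]
        rw [hS', lt_abs]; left; omega
      obtain ⟨g'', hM, hpath⟩ := up g' (Or.inl hcol)
      exact ⟨g'', hM, hrun.trans hpath⟩

/-- The maneuver regions `mW v k` (boxes of radius `48k`) are hole-free. [folklore] -/
theorem holeFree_mW (v : Site 2) (k : ℕ) : HoleFree (mW v k) := by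
  have := holeFree_box v (48 * (k : ℤ))
  simpa [mW] using this

/-! ### Box bookkeeping -/

/-- Membership in `mW`. [folklore] -/
theorem mem_mW_iff {v x : Site 2} {k : ℕ} :
    x ∈ mW v k ↔ |x 0 - v 0| ≤ 48 * k ∧ |x 1 - v 1| ≤ 48 * k := Iff.rfl

/-- Membership in `mB`. [folklore] -/
theorem mem_mB_iff {v x : Site 2} {k : ℕ} :
    x ∈ mB v k ↔ |x 0 - v 0| ≤ 12 * k ∧ |x 1 - v 1| ≤ 12 * k := Iff.rfl

/-- The centre lies in its start box. [folklore] -/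
theorem self_mem_mB (v : Site 2) (k : ℕ) : v ∈ mB v k := by
  rw [mem_mB_iff]; constructor <;> simp

/-- `mW` is monotone in the scale. [folklore] -/
theorem mW_mono (v : Site 2) {k k' : ℕ} (hk : k ≤ k') : mW v k ⊆ mW v k' := by
  intro x hx
  rw [mem_mW_iff] at hx ⊢
  have : (k : ℤ) ≤ k' := by exact_mod_cast hk
  constructor <;> nlinarith [hx.1, hx.2]

/-- The region of scale `k` about a point of the start box lies in the region of scale `2k`.
[folklore] -/
theorem mW_subset_mW_two_mul {v x : Site 2} {k : ℕ} (hx : x ∈ mB v k) : mW x k ⊆ mW v (2 * k) := by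
  intro y hy
  rw [mem_mB_iff] at hx
  rw [mem_mW_iff] at hy ⊢
  push_cast
  obtain ⟨hx0, hx1⟩ := hx
  obtain ⟨hy0, hy1⟩ := hy
  rw [abs_le] at hx0 hx1 hy0 hy1 ⊢
  refine ⟨⟨by linarith, by linarith⟩, ?_⟩
  rw [abs_le]
  exact ⟨by linarith, by linarith⟩

/-- Symmetry of the start box. [folklore] -/
theorem mem_mB_comm {v x : Site 2} {k : ℕ} (hx : x ∈ mB v k) : v ∈ mB x k := by
  rw [mem_mB_iff] at hx ⊢
  rw [abs_sub_comm (v 0), abs_sub_comm (v 1)]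
  exact hx

/-- The region of scale `2k` together with its outer boundary lies in the start box of scale `9k`
(`96k + 1 ≤ 108k`). [folklore] -/
theorem mW_union_outer_subset_mB {v : Site 2} {k : ℕ} (hk : 0 < k) :
    mW v (2 * k) ∪ latticeOuterBoundary (mW v (2 * k)) ⊆ mB v (9 * k) := by
  have hk' : (1 : ℤ) ≤ k := by exact_mod_cast hk
  rintro w (hw | ⟨-, u, hu, j, rfl⟩)
  · rw [mem_mW_iff] at hw
    rw [mem_mB_iff]
    push_cast at hw ⊢
    constructor <;> nlinarith [hw.1, hw.2]
  · rw [mem_mW_iff] at hu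
    rw [mem_mB_iff]
    push_cast at hu ⊢
    have h0 : |cornerUnit j 0| ≤ 1 := by fin_cases j <;> simp [cornerUnit]
    have h1 : |cornerUnit j 1| ≤ 1 := by fin_cases j <;> simp [cornerUnit]
    simp only [Pi.add_apply]
    obtain ⟨hu0, hu1⟩ := hu
    rw [abs_le] at hu0 hu1 h0 h1 ⊢
    refine ⟨⟨by linarith, by linarith⟩, ?_⟩
    rw [abs_le]
    exact ⟨by linarith, by linarith⟩

/-- The start box of scale `9k` lies in the region of scale `2 · 9k`. [folklore] -/
theorem mB_subset_mW' (v : Site 2) (k : ℕ) : mB v k ⊆ mW v (2 * k) :=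
  mB_subset_mW.trans (mW_mono v (by omega))

/-! ### Two-sided Harnack inequality -/

/-- **Two-sided Harnack inequality in a box.** If `h` is lattice harmonic on `mW v (2k)` and
nonnegative on it and on its outer boundary (`k ≥ 1`), then for every `x ∈ mB v k`,
`(c_*/2) h v ≤ h x` and `(c_*/2) h x ≤ h v`. [folklore] -/
theorem harnack_two_sided {h : Site 2 → ℝ} {v : Site 2} {k : ℕ} (hk : 0 < k)
    (hh : IsLatticeHarmonicOn h (mW v (2 * k)))
    (hpos : ∀ w ∈ mW v (2 * k) ∪ latticeOuterBoundary (mW v (2 * k)), 0 ≤ h w)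
    {x : Site 2} (hx : x ∈ mB v k) :
    maneuverConst / 2 * h v ≤ h x ∧ maneuverConst / 2 * h x ≤ h v :=
  ⟨harnack_one_scale (mW_finite v _) (holeFree_mW v _) hh hpos hk (mW_mono v (by omega)) hx,
    harnack_one_scale (mW_finite v _) (holeFree_mW v _) hh hpos hk (mW_subset_mW_two_mul hx)
      (mem_mB_comm hx)⟩

/-! ### Oscillation decay -/

/-- The oscillation claim at depth `N`: for `h` lattice harmonic on `mW v (2 · 9^N k)` and
nonnegative on it and its outer boundary, `h x - h y ≤ θ^N (2/c_*) h v` for all `x, y ∈ mB v k`,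
with `θ = (C-1)/(C+1)`, `C = (2/c_*)²`. Induction on `N` (Moser's iteration). [folklore] -/
theorem osc_decay (N : ℕ) : ∀ (k : ℕ), 0 < k → ∀ (h : Site 2 → ℝ) (v : Site 2),
    IsLatticeHarmonicOn h (mW v (2 * (9 ^ N * k))) →
    (∀ w ∈ mW v (2 * (9 ^ N * k)) ∪ latticeOuterBoundary (mW v (2 * (9 ^ N * k))), 0 ≤ h w) →
    ∀ x ∈ mB v k, ∀ y ∈ mB v k,
      h x - h y ≤ (((2 / maneuverConst) ^ 2 - 1) / ((2 / maneuverConst) ^ 2 + 1)) ^ N *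
        (2 / maneuverConst) * h v := by
  have hc := maneuverConst_pos
  have hc1 := maneuverConst_le_one
  set a : ℝ := 2 / maneuverConst with ha
  have ha2 : 2 ≤ a := by rw [ha, le_div_iff₀ hc]; linarith
  have hapos : 0 < a := by linarith
  -- `c_*/2 * t ≤ s ↔ t ≤ a * s`
  have key : ∀ t s : ℝ, maneuverConst / 2 * t ≤ s → t ≤ a * s := by
    intro t s hts
    rw [ha]
    rw [div_mul_eq_mul_div, le_div_iff₀ hc]
    linarith
  induction N with
  | zero =>
    intro k hk h v hh hpos x hx y hy
    simp only [pow_zero, one_mul] at hh hpos ⊢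
    have hy0 : 0 ≤ h y := hpos y (Or.inl (mB_subset_mW' v k hy))
    have hxv := key _ _ (harnack_two_sided hk hh hpos hx).2
    linarith
  | succ N ih =>
    intro k hk h v hh hpos x hx y hy
    set C : ℝ := a ^ 2 with hC
    set θ : ℝ := (C - 1) / (C + 1) with hθ
    have hC4 : 4 ≤ C := by rw [hC]; nlinarith
    -- the previous scale `k' = 9k`
    have hk' : 0 < 9 * k := by omega
    have hpow : 9 ^ (N + 1) * k = 9 ^ N * (9 * k) := by ring
    rw [hpow] at hh hpos
    have ih' := ih (9 * k) hk' h v hh hpos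
    -- extrema of `h` on `B' = mB v (9k)`
    have hfin : (mB v (9 * k)).Finite := (mW_finite v (9 * k)).subset mB_subset_mW
    have hne : (mB v (9 * k)).Nonempty := ⟨v, self_mem_mB v _⟩
    obtain ⟨xM, hxM, hM⟩ := Set.exists_max_image (mB v (9 * k)) h hfin hne
    obtain ⟨xm, hxm, hm⟩ := Set.exists_min_image (mB v (9 * k)) h hfin hne
    have hosc : h xM - h xm ≤ θ ^ N * a * h v := ih' xM hxM xm hxm
    -- the region of scale `2k` and its outer boundary lie in `B'`, inside the harmonic region
    have hsub : mW v (2 * k) ∪ latticeOuterBoundary (mW v (2 * k)) ⊆ mB v (9 * k) :=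
      mW_union_outer_subset_mB hk
    have hharm : mW v (2 * k) ⊆ mW v (2 * (9 ^ N * (9 * k))) :=
      mW_mono v (by
        have : 1 ≤ 9 ^ N := Nat.one_le_pow _ _ (by norm_num)
        nlinarith)
    have hh₂ : IsLatticeHarmonicOn h (mW v (2 * k)) := fun w hw => hh w (hharm hw)
    -- Harnack for `h - m`
    have hg₁ : IsLatticeHarmonicOn (fun w => h w - h xm) (mW v (2 * k)) := hh₂.sub_const _
    have hg₁pos : ∀ w ∈ mW v (2 * k) ∪ latticeOuterBoundary (mW v (2 * k)), 0 ≤ h w - h xm :=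
      fun w hw => sub_nonneg.2 (hm w (hsub hw))
    -- Harnack for `M - h`
    have hg₂ : IsLatticeHarmonicOn (fun w => h xM - h w) (mW v (2 * k)) := by
      intro w hw
      have e : (fun w => h xM - h w) = (fun _ => h xM) - h := by funext z; rfl
      rw [e, latticeLaplacian_sub, latticeLaplacian_const, hh₂ w hw, sub_zero]
    have hg₂pos : ∀ w ∈ mW v (2 * k) ∪ latticeOuterBoundary (mW v (2 * k)), 0 ≤ h xM - h w :=
      fun w hw => sub_nonneg.2 (hM w (hsub hw))
    -- (1) `h x - m ≤ C (h y - m)`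
    have h1a := key _ _ (harnack_two_sided hk hg₁ hg₁pos hx).2   -- h x - m ≤ a (h v - m)
    have h1b := key _ _ (harnack_two_sided hk hg₁ hg₁pos hy).1   -- h v - m ≤ a (h y - m)
    have h1 : h x - h xm ≤ C * (h y - h xm) := by
      calc h x - h xm ≤ a * (h v - h xm) := h1a
        _ ≤ a * (a * (h y - h xm)) := mul_le_mul_of_nonneg_left h1b hapos.le
        _ = C * (h y - h xm) := by rw [hC]; ring
    -- (2) `M - h y ≤ C (M - h x)`
    have h2a := key _ _ (harnack_two_sided hk hg₂ hg₂pos hy).2   -- M - h y ≤ a (M - h v)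
    have h2b := key _ _ (harnack_two_sided hk hg₂ hg₂pos hx).1   -- M - h v ≤ a (M - h x)
    have h2 : h xM - h y ≤ C * (h xM - h x) := by
      calc h xM - h y ≤ a * (h xM - h v) := h2a
        _ ≤ a * (a * (h xM - h x)) := mul_le_mul_of_nonneg_left h2b hapos.le
        _ = C * (h xM - h x) := by rw [hC]; ring
    -- add and rearrange: `(1 + C)(h x - h y) ≤ (C - 1)(M - m)`
    have h3 : (1 + C) * (h x - h y) ≤ (C - 1) * (h xM - h xm) := by linarith
    have hCp : 0 < C + 1 := by linarith
    have h4 : h x - h y ≤ θ * (h xM - h xm) := by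
      rw [hθ, div_mul_eq_mul_div, le_div_iff₀ hCp]
      linarith
    have hθ0 : 0 ≤ θ := by rw [hθ]; exact div_nonneg (by linarith) hCp.le
    calc h x - h y ≤ θ * (h xM - h xm) := h4
      _ ≤ θ * (θ ^ N * a * h v) := mul_le_mul_of_nonneg_left hosc hθ0
      _ = θ ^ (N + 1) * a * h v := by ring

/-- **Oscillation decay / Harnack modulus in boxes** (registered helper for
`stub_touchProfileLaws`): there are universal constants `A > 0` and `θ ∈ [0,1)` such that for
every depth `N`, every `k ≥ 1`, every `h` lattice harmonic on the box `mW v (2 · 9^N k)` (radius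
`96 · 9^N k`) and nonnegative on it and on its outer boundary, and every `x` in the box `mB v k`
(radius `12k`): `|h x - h v| ≤ A θ^N h v`. (`A = 2/c_*`, `θ = (A²-1)/(A²+1)`.) [folklore] -/
theorem harnack_modulus_box : ∃ A θ : ℝ, 0 < A ∧ 0 ≤ θ ∧ θ < 1 ∧
    ∀ (N k : ℕ), 0 < k → ∀ (h : Site 2 → ℝ) (v : Site 2),
      IsLatticeHarmonicOn h (mW v (2 * (9 ^ N * k))) →
      (∀ w ∈ mW v (2 * (9 ^ N * k)) ∪ latticeOuterBoundary (mW v (2 * (9 ^ N * k))), 0 ≤ h w) →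
      ∀ x ∈ mB v k, |h x - h v| ≤ A * θ ^ N * h v := by
  have hc := maneuverConst_pos
  have hc1 := maneuverConst_le_one
  set a : ℝ := 2 / maneuverConst with ha
  have ha2 : 2 ≤ a := by rw [ha, le_div_iff₀ hc]; linarith
  have hC1 : 0 < a ^ 2 + 1 := by positivity
  refine ⟨a, (a ^ 2 - 1) / (a ^ 2 + 1), by linarith, div_nonneg (by nlinarith) hC1.le,
    (div_lt_one hC1).2 (by linarith), ?_⟩
  intro N k hk h v hh hpos x hx
  have hxv := osc_decay N k hk h v hh hpos x hx v (self_mem_mB v k)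
  have hvx := osc_decay N k hk h v hh hpos v (self_mem_mB v k) x hx
  rw [abs_le]
  constructor <;> linarith

end Summit.CriticalPhenomena.CardyFormulaZ2.Cruxes.ParafermionPrecompact.KenyonStreamSecondRelation

end
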